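import Literature.AnabelianGeometry.EtaleTheta.ThetaCoversTemperedModelDefs
import Literature.AnabelianGeometry.SemiGraphs.ProfiniteCompletionEta
import HarnessLib

/-!
# The MONODROMY MODEL of the tempered theta-covering interface ([EtTh] §2, Def. 2.1 – Def. 2.5), part 1:
# pulling `CoverDataAx` back along a surjection; the discrete tempered group `(ℤ/l × ℤ/l) ⋊ D_∞ × ℤ/2`,
# its finite shadow, its profinite completion, and the `CoverDataAx` of the model

S. Mochizuki, *The étale theta function and its Frobenioid-theoretic manifestations* [EtTh], Publ. RIMS **45**
(2009), §1 p. 12 («`Π^tp_X ↠ Z`»), §2 Def. 2.1 – Prop. 2.2 (PDF pp. 35–38), Def. 2.5 (pp. 39–40), Prop. 2.4 / 2.6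
(pp. 38–40) [cite: MochizukiEtTh2009, Def 2.1 p.36] [cite: MochizukiEtTh2009, Def 2.5 p.39].  Cell abc-iut, layer L2,
seat abc-iut-w6-d084 (gen 7), row CNP26 / «P26-NV MONODROMY TOY» (non-vacuity of the instance forms of FACT-LIST
F-0609 `TemperedCoverData.Prop24` / F-0610 `TemperedCoverData.Prop26`, which FAIL at every previously decided
datum: abc-iut-f-143 p435476, abc-iut-f-151 p475371, this seat p489452).

HONEST LABEL (abc-iut-L2-lead R1352): a DESIGNED tempered toy with print's monodromy combinatorics — loop ↦ `Δ̄^ell`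
(`b`-cycle), the inversion INVERTS it, unipotent monodromy `x ↦ x·z` on the `a`-cycle, `z` = cusp inertia = `Δ̄_Θ`
central; `G_K := 1`; NOT a Tate curve, NOT the tempered fundamental group of a curve; consistency ≠ faithfulness;
nothing here takes a side on anything printed.  DEF-BEARING (class (b) MODEL/CONSTRUCTION file: no frozen
structure is touched; instances only on the NEW type synonym `TG`).

WHY A NEW MODEL.  The toy of record (abc-iut-w5-d118, `ThetaCoversTemperedModelDefs.lean`) puts the tempered loop
`t` (the generator of `Z = Π^tp_X/Π^tp_Y ≅ ℤ`, §1 p. 12) in the THETA direction (`Δ̄_Θ ≅ Ẑ/lẐ`), so the inversion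
centralises `t` and `Π^tp_C = A × ℤ` is a direct product; the central twists `t^l ↦ z · t^l` of the members of the
tower then have no extension to `Π^tp_C` and the typed Prop. 2.4 / 2.6 fail (p435476).  In print the loop maps to
`Δ̄^ell_X` (the `b`-cycle of the Tate curve), the inversion INVERTS it ([EtTh] Rmk. 2.1.1: `−1` on `Δ̄^ell_X`), and
`t` acts on the `a`-cycle by the unipotent MONODROMY `x ↦ x · z` (`z` = the cusp inertia generating `Δ̄_Θ`).  The
model built here follows print's combinatorics: it UNWINDS the rotation `r ∈ D_l` of abc-iut-w5-d243's finite
Heisenberg witness `heisPiC l = (ℤ/l × ℤ/l) ⋊ D_l` (`ThetaCoversHeisenbergWitness.lean`, a `CoverDataAx l`) to an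
element `t` of infinite order:
* `Π^tp_C := TG l := ((ℤ/l × ℤ/l) ⋊ D_∞) × ℤ/2` (DISCRETE), `D_∞ = ⟨t, ι⟩ =` Mathlib's `DihedralGroup 0` acting
  through `D_∞ ↠ D_l` by the witness's action `theta l` (`t · (b, c) = (b, c + b)`, `ι · (b, c) = (−b, c)`); the
  factor `ℤ/2 = ⟨e⟩` carries the double covering `Ÿ → Y`;
* the finite SHADOW `sh : TG l ↠ TA l = heisPiC l × ℤ/2` (abc-iut-w5-d118's finite factor), kernel `⟨t^l⟩`;
* `Π_C := (TG l)^∧`, Mathlib's profinite completion, `toHat := η` (a profinite completion in the sense of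
  abc-iut-L3's `IsProfiniteCompletion` by abc-iut-w5-d218's `isProfiniteCompletion_of_eta`; injective because
  `TG l` is residually finite), and the continuous extension `Sh : Π_C ↠ TA l` of the shadow;
* `CoverDataAx.comapOfSurjective` (generic, this file): every `CoverDataAx l` pulls back along a continuous
  surjective homomorphism onto its `Π_C` (all twenty-odd axioms transfer); the model's profinite cover data are
  `coverDataAx l hl := (heisenbergWitness l hl).comapOfSurjective Φ` with `Φ := pr_Heis ∘ Sh : Π_C ↠ heisPiC l` — so
  `G_K = 1`, `Δ̄_X = Heis_l` (genuinely non-abelian, `⁅Δ̄_X, Δ̄_X⁆ = Δ̄_Θ = ⟨z⟩`), `Ker(Δ_X ↠ Δ̄_X) = Ker Φ ⊇ ⟨e, t^l⟩`.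
Sequels: the tempered layer (Def. 2.5) with `Π_{C̲̲} := Φ⁻¹(D_l)`, and the typed Prop. 2.4 / 2.6 AT THE MODEL.
-/

noncomputable section

namespace Literature.AnabelianGeometry.EtaleTheta

namespace ThetaCovers

open Multiplicative HeisenbergWitness TemperedModel Literature.AnabelianGeometry.SemiGraphs
  Literature.AnabelianGeometry.EtaleTheta.SettingModel

universe u

/-! ## 1. Pulling a `CoverDataAx` back along a continuous surjection onto its `Π_C` -/

namespace CoverDataAx

variable {l : ℕ}

/-- Transfer of the rank-two quotient along a surjection: `Φ⁻¹(Δ_X)/Φ⁻¹(Δ̄_Θ-preimage) ≅ Δ_X/Δ̄_Θ-preimage`.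
(pull-back bookkeeping for the typed interface of [EtTh] Def. 2.1; no claim about print)
[cite: MochizukiEtTh2009, Def 2.1 p.36] -/
theorem nonempty_quotient_comap_mulEquiv {N Q : Type*} [Group N] [Group Q] (Ψ : Q →* N)
    (hΨs : Function.Surjective Ψ) (D B : Subgroup N) [B.Normal] {M : Type*} [Group M]
    (e : ↥D ⧸ B.subgroupOf D ≃* M) :
    Nonempty (↥(D.comap Ψ) ⧸ (B.comap Ψ).subgroupOf (D.comap Ψ) ≃* M) := by
  let ψ : ↥(D.comap Ψ) →* ↥D ⧸ B.subgroupOf D :=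
    (QuotientGroup.mk' (B.subgroupOf D)).comp (Ψ.subgroupComap D)
  have hψs : Function.Surjective ψ :=
    (QuotientGroup.mk'_surjective _).comp (Ψ.subgroupComap_surjective_of_surjective D hΨs)
  have hker : ψ.ker = (B.comap Ψ).subgroupOf (D.comap Ψ) := by
    ext x
    rw [MonoidHom.mem_ker, MonoidHom.comp_apply, QuotientGroup.mk'_apply, QuotientGroup.eq_one_iff,
      Subgroup.mem_subgroupOf, Subgroup.mem_subgroupOf, Subgroup.mem_comap]
    rfl
  exact ⟨(QuotientGroup.quotientMulEquivOfEq hker.symm).trans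
    ((QuotientGroup.quotientKerEquivOfSurjective ψ hψs).trans e)⟩

/-- **Pull-back of the profinite cover data of [EtTh] Def. 2.1 / Rmk. 2.1.1 / Prop. 2.2 (i) along a continuous
surjective homomorphism `Φ : P ↠ Π_C`**: `Π_C := P`, same `G_K`, `aug := aug ∘ Φ`, and every subgroup datum
(`Π_X`, `Ker(Δ_X ↠ Δ̄_X)`, the `Δ̄_Θ`-preimage, `D_x`) replaced by its preimage; all axioms transfer (indices and
relative indices along a surjection, the rank-two quotient by `nonempty_quotient_comap_mulEquiv`, the element-wise
axioms by evaluation at `Φ`). (generic bookkeeping for the typed interface; no claim about print)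
[cite: MochizukiEtTh2009, Def 2.1 p.36] -/
def comapOfSurjective (X : CoverDataAx.{u} l) {P : Type u} [Group P] [TopologicalSpace P]
    [IsTopologicalGroup P] (Φ : P →* X.PiC) (hΦc : Continuous Φ) (hΦs : Function.Surjective Φ) :
    CoverDataAx.{u} l where
  l_odd := X.l_odd
  PiC := P
  GK := X.GK
  aug := X.aug.comp Φ
  PiX := X.PiX.comap Φ
  PiX_normal := X.PiX_normal.comap Φ
  index_PiX := by rw [Subgroup.index_comap_of_surjective _ hΦs, X.index_PiX]
  isOpen_PiX := X.isOpen_PiX.preimage hΦc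
  aug_PiX_surjective := by
    intro k
    obtain ⟨⟨x, hx⟩, hxk⟩ := X.aug_PiX_surjective k
    obtain ⟨p, rfl⟩ := hΦs x
    exact ⟨⟨p, hx⟩, hxk⟩
  barKer := X.barKer.comap Φ
  barKer_normal := X.barKer_normal.comap Φ
  isClosed_barKer := X.isClosed_barKer.preimage hΦc
  barTheta := X.barTheta.comap Φ
  barTheta_normal := X.barTheta_normal.comap Φ
  barKer_le_barTheta := Subgroup.comap_mono X.barKer_le_barTheta
  barTheta_le := by
    rw [← MonoidHom.comap_ker, ← Subgroup.comap_inf]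
    exact Subgroup.comap_mono X.barTheta_le
  relIndex_barKer := by
    rw [Subgroup.relIndex_comap, Subgroup.map_comap_eq_self_of_surjective hΦs, X.relIndex_barKer]
  ell_rank_two := by
    haveI := X.barTheta_normal
    exact nonempty_quotient_comap_mulEquiv Φ hΦs (X.PiX ⊓ X.aug.ker) X.barTheta
      (Classical.choice X.ell_rank_two)
  barTheta_central := by
    intro t ht d hd
    rw [← MonoidHom.comap_ker, ← Subgroup.comap_inf] at hd
    rw [Subgroup.mem_comap, map_mul, map_mul, map_mul, map_inv, map_inv]
    exact X.barTheta_central (Φ t) ht (Φ d) hd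
  Dx := X.Dx.comap Φ
  Dx_le := Subgroup.comap_mono X.Dx_le
  aug_Dx_surjective := by
    intro k
    obtain ⟨⟨x, hx⟩, hxk⟩ := X.aug_Dx_surjective k
    obtain ⟨p, rfl⟩ := hΦs x
    exact ⟨⟨p, hx⟩, hxk⟩
  inertia_sup_barKer := by
    rw [← MonoidHom.comap_ker, ← Subgroup.comap_inf]
    refine le_antisymm ?_ ?_
    · rw [← X.inertia_sup_barKer]
      exact sup_le (Subgroup.comap_mono le_sup_left) (Subgroup.comap_mono le_sup_right)
    · intro g hg
      haveI := X.barKer_normal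
      haveI : (X.barKer.comap Φ).Normal := X.barKer_normal.comap Φ
      rw [Subgroup.mem_comap, ← X.inertia_sup_barKer] at hg
      obtain ⟨d, hd, k, hk, hdk⟩ := Subgroup.mem_sup_of_normal_right.mp hg
      obtain ⟨d', rfl⟩ := hΦs d
      have hrest : d'⁻¹ * g ∈ X.barKer.comap Φ := by
        rw [Subgroup.mem_comap, map_mul, map_inv, ← hdk, inv_mul_cancel_left]
        exact hk
      exact Subgroup.mem_sup_of_normal_right.mpr ⟨d', hd, d'⁻¹ * g, hrest, mul_inv_cancel_left d' g⟩
  pow_mem_barKer := by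
    intro d hd
    rw [← MonoidHom.comap_ker, ← Subgroup.comap_inf] at hd
    rw [Subgroup.mem_comap, map_pow]
    exact X.pow_mem_barKer (Φ d) hd
  inv_ell := by
    intro c hc hcX d hd
    rw [← MonoidHom.comap_ker, ← Subgroup.comap_inf] at hd
    rw [Subgroup.mem_comap, map_mul, map_mul, map_mul, map_inv]
    exact X.inv_ell (Φ c) hc hcX (Φ d) hd
  inv_theta := by
    intro c hc hcX t ht
    rw [Subgroup.mem_comap, map_mul, map_mul, map_mul, map_inv, map_inv]
    exact X.inv_theta (Φ c) hc hcX (Φ t) ht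

end CoverDataAx

/-! ## 2. The infinite dihedral group `D_∞` and its reductions `D_∞ ↠ D_n` -/

namespace MonodromyModel

variable (l : ℕ)

/-- The reduction `D_∞ ↠ D_n`, `r^i ↦ r^{i mod n}`, `s r^i ↦ s r^{i mod n}` (Mathlib's `DihedralGroup 0` has
`ZMod 0 = ℤ` as index type). (toy bookkeeping for [EtTh] §1 p. 12 «`Π^tp_X ↠ Z`»; no claim about print)
[cite: MochizukiEtTh2009, §1 p.12] -/
def dihedralRed (n : ℕ) : DihedralGroup 0 →* DihedralGroup n where
  toFun g := match g with
    | DihedralGroup.r i => DihedralGroup.r (ZMod.castHom (dvd_zero n) (ZMod n) i)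
    | DihedralGroup.sr i => DihedralGroup.sr (ZMod.castHom (dvd_zero n) (ZMod n) i)
  map_one' := by
    rw [DihedralGroup.one_def, DihedralGroup.one_def]
    exact congrArg DihedralGroup.r (map_zero _)
  map_mul' g h := by
    rcases g with i | i <;> rcases h with j | j
    · simp only [DihedralGroup.r_mul_r, map_add]
    · simp only [DihedralGroup.r_mul_sr, map_sub]
    · simp only [DihedralGroup.sr_mul_r, map_add]
    · simp only [DihedralGroup.sr_mul_sr, map_sub]

/-- `dihedralRed` on a rotation. (toy bookkeeping; no claim about print) [cite: MochizukiEtTh2009, §1 p.12] -/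
@[simp] theorem dihedralRed_r (n : ℕ) (i : ZMod 0) :
    dihedralRed n (DihedralGroup.r i) = DihedralGroup.r (ZMod.castHom (dvd_zero n) (ZMod n) i) := rfl

/-- `dihedralRed` on a reflection. (toy bookkeeping; no claim about print) [cite: MochizukiEtTh2009, §1 p.12] -/
@[simp] theorem dihedralRed_sr (n : ℕ) (i : ZMod 0) :
    dihedralRed n (DihedralGroup.sr i) = DihedralGroup.sr (ZMod.castHom (dvd_zero n) (ZMod n) i) := rfl

/-- `dihedralRed` is surjective. (toy bookkeeping; no claim about print) [cite: MochizukiEtTh2009, §1 p.12] -/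
theorem dihedralRed_surjective (n : ℕ) : Function.Surjective (dihedralRed n) := by
  intro g
  rcases g with j | j
  · obtain ⟨i, hi⟩ := ZMod.ringHom_surjective (ZMod.castHom (dvd_zero n) (ZMod n)) j
    exact ⟨DihedralGroup.r i, by rw [dihedralRed_r, hi]⟩
  · obtain ⟨i, hi⟩ := ZMod.ringHom_surjective (ZMod.castHom (dvd_zero n) (ZMod n)) j
    exact ⟨DihedralGroup.sr i, by rw [dihedralRed_sr, hi]⟩

/-! ## 3. The discrete tempered group `TG l = ((ℤ/l × ℤ/l) ⋊ D_∞) × ℤ/2` and its finite shadow -/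

/-- The action of `D_∞` on `ℤ/l × ℤ/l` through `D_∞ ↠ D_l` and the witness's action `theta l`:
`t = r · (b, c) = (b, c + b)` (unipotent monodromy), `ι = s · (b, c) = (−b, c)`.
(toy bookkeeping for the typed interface of [EtTh] Def. 2.1 / Rmk. 2.1.1; no claim about print)
[cite: MochizukiEtTh2009, Def 2.1 p.36] -/
def thetaInf : DihedralGroup 0 →* MulAut (Multiplicative (ZMod l × ZMod l)) := (theta l).comp (dihedralRed l)

/-- `thetaInf = theta ∘ dihedralRed` pointwise. (toy bookkeeping; no claim about print)
[cite: MochizukiEtTh2009, Def 2.1 p.36] -/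
@[simp] theorem thetaInf_apply (g : DihedralGroup 0) : thetaInf l g = theta l (dihedralRed l g) := rfl

/-- `Π^tp_Ċ` of the model as a bare group: `(ℤ/l × ℤ/l) ⋊ D_∞`. (toy bookkeeping for the typed interface of
[EtTh] Def. 2.5; no claim about print) [cite: MochizukiEtTh2009, Def 2.5 p.39] -/
abbrev TG₀ : Type := Multiplicative (ZMod l × ZMod l) ⋊[thetaInf l] DihedralGroup 0

/-- **`Π^tp_C` of the model**: `TG l := ((ℤ/l × ℤ/l) ⋊ D_∞) × ℤ/2` (a NEW type synonym, so that it may carry the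
discrete topology). (toy bookkeeping for the typed interface of [EtTh] Def. 2.5; no claim about print)
[cite: MochizukiEtTh2009, Def 2.5 p.39] -/
def TG : Type := TG₀ l × Multiplicative (ZMod 2)

/-- The product group structure. (toy bookkeeping) [cite: MochizukiEtTh2009, Def 2.5 p.39] -/
instance : Group (TG l) := inferInstanceAs (Group (TG₀ l × Multiplicative (ZMod 2)))

/-- `Π^tp_C` of the model is DISCRETE. (toy bookkeeping) [cite: MochizukiEtTh2009, Def 2.5 p.39] -/
instance : TopologicalSpace (TG l) := ⊥

/-- `Π^tp_C` of the model is discrete. (toy bookkeeping) [cite: MochizukiEtTh2009, Def 2.5 p.39] -/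
instance : DiscreteTopology (TG l) := ⟨rfl⟩

/-- A discrete group is a topological group. (toy bookkeeping) [cite: MochizukiEtTh2009, Def 2.5 p.39] -/
instance : IsTopologicalGroup (TG l) where
  continuous_mul := continuous_of_discreteTopology
  continuous_inv := continuous_of_discreteTopology

/-- First projection `TG l → (ℤ/l × ℤ/l) ⋊ D_∞` (forgetting the `Ÿ`-sheet). (toy bookkeeping; no claim about print)
[cite: MochizukiEtTh2009, Def 2.5 p.39] -/
def TG.fst : TG l →* TG₀ l := MonoidHom.fst (TG₀ l) (Multiplicative (ZMod 2))

/-- The shadow on the first factor: `(ℤ/l × ℤ/l) ⋊ D_∞ ↠ (ℤ/l × ℤ/l) ⋊ D_l = heisPiC l`.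
(toy bookkeeping; no claim about print) [cite: MochizukiEtTh2009, Def 2.1 p.36] -/
def sh₀ : TG₀ l →* heisPiC l :=
  SemidirectProduct.map (MonoidHom.id _) (dihedralRed l) (fun _ => rfl)

/-- **The finite shadow** `sh : TG l ↠ TA l = heisPiC l × ℤ/2`, `t ↦ r`, with kernel `⟨t^l⟩`.
(toy bookkeeping; no claim about print) [cite: MochizukiEtTh2009, Def 2.1 p.36] -/
def sh : TG l →* TA l := (sh₀ l).prodMap (MonoidHom.id (Multiplicative (ZMod 2)))

/-- Components of the shadow. (toy bookkeeping; no claim about print) [cite: MochizukiEtTh2009, Def 2.1 p.36] -/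
@[simp] theorem heis_sh (g : TG l) : TA.heis l (sh l g) = sh₀ l g.1 := rfl

/-- `sh₀` on the left component is the identity. (toy bookkeeping; no claim about print) [cite: MochizukiEtTh2009, Def 2.1 p.36] -/
@[simp] theorem sh₀_left (g : TG₀ l) : (sh₀ l g).left = g.left := rfl

/-- `sh₀` on the right component is `dihedralRed`. (toy bookkeeping; no claim about print) [cite: MochizukiEtTh2009, Def 2.1 p.36] -/
@[simp] theorem sh₀_right (g : TG₀ l) : (sh₀ l g).right = dihedralRed l g.right := rfl

/-- The shadow `sh₀` is surjective. (toy bookkeeping; no claim about print) [cite: MochizukiEtTh2009, Def 2.1 p.36] -/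
theorem sh₀_surjective : Function.Surjective (sh₀ l) := by
  intro h
  obtain ⟨d, hd⟩ := dihedralRed_surjective l h.right
  exact ⟨⟨h.left, d⟩, SemidirectProduct.ext rfl hd⟩

/-- The shadow `sh` is surjective. (toy bookkeeping; no claim about print) [cite: MochizukiEtTh2009, Def 2.1 p.36] -/
theorem sh_surjective : Function.Surjective (sh l) := by
  intro a
  obtain ⟨g, hg⟩ := sh₀_surjective l a.1
  exact ⟨(g, a.2), Prod.ext hg rfl⟩

/-- `TG l` is residually finite: the shadows `sh` and `TG l ↠ D_∞ ↠ D_n` separate points.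
(toy bookkeeping for [EtTh] §1 p. 12 «`Π_X := (Π^tp_X)^∧`»; no claim about print) [cite: MochizukiEtTh2009, §1 p.12] -/
theorem residuallyFinite [NeZero l] : Group.ResiduallyFinite (TG l) := by
  refine Group.residuallyFinite_of_forall_exists_finite_monoidHom.{0} fun g hg => ?_
  by_cases hd : g.1.right = 1
  · -- the `D_∞`-component is trivial: the finite shadow `sh` sees `g`
    refine ⟨TA l, inferInstance, inferInstance, sh l, fun h1 => hg ?_⟩
    have h2 : (sh l g).2 = g.2 := rfl
    have h3 : (TA.heis l (sh l g)).left = g.1.left := rfl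
    rw [h1] at h2 h3
    refine Prod.ext (SemidirectProduct.ext ?_ hd) ?_
    · exact h3.symm
    · exact h2.symm
  · -- the `D_∞`-component `r^i` (`i ≠ 0`) or `s r^i` survives in `D_n`, `n = |i| + 1`
    rcases hi : g.1.right with i | i
    · haveI : NeZero (i.natAbs + 1) := ⟨Nat.succ_ne_zero _⟩
      refine ⟨DihedralGroup (i.natAbs + 1), inferInstance, inferInstance,
        (dihedralRed (i.natAbs + 1)).comp (SemidirectProduct.rightHom.comp (TG.fst l)), fun h1 => ?_⟩
      have h1' : dihedralRed (i.natAbs + 1) g.1.right = 1 := h1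
      rw [hi, dihedralRed_r, DihedralGroup.one_def] at h1'
      have h2 : ZMod.castHom (dvd_zero (i.natAbs + 1)) (ZMod (i.natAbs + 1)) i = 0 := by injection h1'
      rw [ZMod.castHom_apply] at h2
      change ((show ℤ from i) : ZMod (i.natAbs + 1)) = 0 at h2
      rw [ZMod.intCast_zmod_eq_zero_iff_dvd] at h2
      have hi0 : (show ℤ from i) = 0 :=
        Int.eq_zero_of_dvd_of_natAbs_lt_natAbs h2 (by rw [Int.natAbs_natCast]; exact Nat.lt_succ_self _)
      apply hd
      rw [hi, DihedralGroup.one_def]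
      exact congrArg DihedralGroup.r hi0
    · haveI : NeZero (1 : ℕ) := ⟨one_ne_zero⟩
      refine ⟨DihedralGroup 1, inferInstance, inferInstance,
        (dihedralRed 1).comp (SemidirectProduct.rightHom.comp (TG.fst l)), fun h1 => ?_⟩
      have h1' : dihedralRed 1 g.1.right = 1 := h1
      rw [hi, dihedralRed_sr, DihedralGroup.one_def] at h1'
      cases h1'

/-! ## 4. The profinite completion `Π_C`, the extended shadow `Sh : Π_C ↠ TA l`, and the model's `CoverDataAx` -/

/-- **`Π_C` of the model**: `(Π^tp_C)^∧`, Mathlib's profinite completion of the discrete group `TG l`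
([EtTh] §1 p. 12 «`Π_X := (Π^tp_X)^∧`»; [SemiAnbd] Prop. 3.6). (toy bookkeeping; no claim about print)
[cite: MochizukiEtTh2009, §1 p.12] -/
abbrev PiC : Type := ProfiniteGrp.ProfiniteCompletion.completion (GrpCat.of (TG l))

/-- `toHat : Π^tp_C → Π_C`, the canonical map `η` (continuous: `TG l` is discrete). (toy bookkeeping; no claim
about print) [cite: MochizukiEtTh2009, §1 p.12] -/
def toHat : TG l →ₜ* PiC l := etaCont (TG l)

/-- `toHat` is injective ([SemiAnbd] Prop. 3.6 (iii) at the model: `TG l` is residually finite).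
(toy bookkeeping; no claim about print) [cite: MochizukiEtTh2009, §1 p.12] -/
theorem toHat_injective [NeZero l] : Function.Injective (toHat l) := by
  haveI := residuallyFinite l
  exact (ProfiniteGrp.ProfiniteCompletion.etaFn_injective_iff_residuallyFinite (GrpCat.of (TG l))).mpr
    (by assumption)

/-- `toHat : Π^tp_C → Π_C` is a profinite completion in the sense of abc-iut-L3's `IsProfiniteCompletion`
(abc-iut-w5-d218's `isProfiniteCompletion_of_eta`). (toy bookkeeping; no claim about print)
[cite: MochizukiEtTh2009, §1 p.12] -/
theorem isProfiniteCompletion_toHat : IsProfiniteCompletion (toHat l) :=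
  isProfiniteCompletion_of_eta _ (fun _ => rfl)

variable [NeZero l]

/-- `Sh : Π_C ↠ TA l`, the continuous extension of the finite shadow `sh` to the completion.
(toy bookkeeping; no claim about print) [cite: MochizukiEtTh2009, Def 2.1 p.36] -/
def Sh : PiC l →ₜ* TA l :=
  Classical.choose (exists_continuousMonoidHom_extend (TG l) (TA l) (sh l))

/-- `Sh ∘ toHat = sh`. (toy bookkeeping; no claim about print) [cite: MochizukiEtTh2009, Def 2.1 p.36] -/
@[simp] theorem Sh_toHat (g : TG l) : Sh l (toHat l g) = sh l g :=
  Classical.choose_spec (exists_continuousMonoidHom_extend (TG l) (TA l) (sh l)) g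

/-- `Sh` is surjective. (toy bookkeeping; no claim about print) [cite: MochizukiEtTh2009, Def 2.1 p.36] -/
theorem Sh_surjective : Function.Surjective (Sh l) := by
  intro a
  obtain ⟨g, hg⟩ := sh_surjective l a
  exact ⟨toHat l g, by rw [Sh_toHat, hg]⟩

/-- **`Φ := pr_Heis ∘ Sh : Π_C ↠ heisPiC l`**, the coordinate map onto abc-iut-w5-d243's finite Heisenberg witness
along which the profinite cover data are pulled back. (toy bookkeeping; no claim about print)
[cite: MochizukiEtTh2009, Def 2.1 p.36] -/
def Phi : PiC l →* heisPiC l := (TA.heis l).comp (Sh l).toMonoidHom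

/-- `Φ ∘ toHat = sh₀ ∘ pr₁`. (toy bookkeeping; no claim about print) [cite: MochizukiEtTh2009, Def 2.1 p.36] -/
@[simp] theorem Phi_toHat (g : TG l) : Phi l (toHat l g) = sh₀ l g.1 := by
  change TA.heis l (Sh l (toHat l g)) = _
  rw [Sh_toHat]
  rfl

/-- `Φ` is surjective. (toy bookkeeping; no claim about print) [cite: MochizukiEtTh2009, Def 2.1 p.36] -/
theorem Phi_surjective : Function.Surjective (Phi l) := by
  intro h
  obtain ⟨g, hg⟩ := sh₀_surjective l h
  exact ⟨toHat l (g, 1), by rw [Phi_toHat, hg]⟩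

/-- `Φ` is continuous for ANY topology on `heisPiC l` (it factors through the discrete `TA l`).
(toy bookkeeping; no claim about print) [cite: MochizukiEtTh2009, Def 2.1 p.36] -/
theorem continuous_Phi (τ : TopologicalSpace (heisPiC l)) : @Continuous (PiC l) (heisPiC l) _ τ (Phi l) :=
  @Continuous.comp _ _ _ _ _ τ (Sh l) (TA.heis l) continuous_of_discreteTopology (Sh l).continuous

/-- **The profinite cover data of the MONODROMY MODEL** (`CoverDataAx l`, every odd `l`): abc-iut-w5-d243's
Heisenberg witness pulled back along `Φ : Π_C ↠ heisPiC l` — `G_K = 1`, `Π_X = Φ⁻¹((ℤ/l × ℤ/l) ⋊ ⟨r⟩)`,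
`Ker(Δ_X ↠ Δ̄_X) = Ker Φ`, `Δ̄_Θ`-preimage `= D_x = Φ⁻¹(centre)`. CONSISTENCY WITNESS ONLY. (toy bookkeeping;
no claim about print) [cite: MochizukiEtTh2009, Def 2.1 p.36] -/
def coverDataAx (hl : Odd l) : CoverDataAx.{0} l :=
  (heisenbergWitness l hl).comapOfSurjective (Phi l) (continuous_Phi l _) (Phi_surjective l)

/-- `Π_X` of the model is `Φ⁻¹(heisPiX)`. (toy bookkeeping; no claim about print) [cite: MochizukiEtTh2009, Def 2.1 p.36] -/
theorem coverDataAx_PiX (hl : Odd l) : (coverDataAx l hl).PiX = (heisPiX l).comap (Phi l) := rfl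

/-- `Ker(Δ_X ↠ Δ̄_X)` of the model is `Ker Φ`. (toy bookkeeping; no claim about print) [cite: MochizukiEtTh2009, Def 2.1 p.36] -/
theorem coverDataAx_barKer (hl : Odd l) : (coverDataAx l hl).barKer = (Phi l).ker := by
  change (⊥ : Subgroup (heisPiC l)).comap (Phi l) = _
  rw [MonoidHom.comap_bot]

/-- The `Δ̄_Θ`-preimage of the model is `Φ⁻¹(heisTheta)`. (toy bookkeeping; no claim about print)
[cite: MochizukiEtTh2009, Def 2.1 p.36] -/
theorem coverDataAx_barTheta (hl : Odd l) : (coverDataAx l hl).barTheta = (heisTheta l).comap (Phi l) := rfl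

/-- `D_x` of the model is `Φ⁻¹(heisTheta)`. (toy bookkeeping; no claim about print) [cite: MochizukiEtTh2009, Def 2.1 p.36] -/
theorem coverDataAx_Dx (hl : Odd l) : (coverDataAx l hl).Dx = (heisTheta l).comap (Phi l) := rfl

end MonodromyModel

end ThetaCovers

end Literature.AnabelianGeometry.EtaleTheta

end
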